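import Summits.Ventures.CertifiedManyBodySolver.Downfold.EmeryReadingSeam
import HarnessLib

/-!
# Re-pointing ONE entry of a typed box: words that do not read that coordinate transfer BOTH WAYS; for the 3BE seam the
# energy words, the delivered six-box and the fl reading ignore `nHoles`, so a PER-PLANE FILLING variant inherits them all

Venture CertifiedManyBodySolver, cell `pub/hubbard-downfold` (S1 = ROUTER), seat hubbard-downfold-mod-4 (S1/S2 Emery seam); namespace
`Summit.Ventures.CertifiedManyBodySolver.Downfold`. WHY (cell file router/INFLATION-RULES-3to1-B.md §B.34 (d) / §B.35, ruling R-B35 (iii), lead g13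
2026-08-28T04:16:49Z): a multilayer box prints ONE site-mean filling line but may also print LOCATED per-plane fillings (box #201 Bi-2223: n_OP [0.74, 0.77],
n_IP [0.93, 0.94]); the typed 3BE companion of a plane is then RE-POINTED — the same box with its `nHoles` entry replaced — as a NEW decl beside
(`EmeryBoxesKSlicesQ`: four variants, 393 lines, each re-proving entries, fl soundness and vertex floors by hand). This file proves once, generically,
what such a re-pointing does and does not touch, so that every later variant is ONE definition plus one-line corollaries:

* «`W` ignores `c`» = the hypothesis `∀ p v, W p → W (update p c v)` (no new predicate);
* **`HoldsOn.update_of_ignoresCoord`** — THE TRANSFER: a word that ignores `c` and holds on `B` holds on `B` with the `c` entry replaced by ANYTHING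
  (`some e` or `none`); **`HoldsOn.of_update_of_ignoresCoord`** — and conversely (re-point back: `update (update B c x) c (B c) = B`); so the two objects
  carry EXACTLY the same `c`-blind words (`holdsOn_update_iff_of_ignoresCoord`);
* `Box.mem_update_update` — pointwise form: `p ∈ B`, `v ∈ e` ⇒ `update p c v ∈ update B c (some e)`; `Box.mem_of_mem_update_none` — erasing an entry only
  enlarges the box; `Entry.fst_mem` — every entry is inhabited (its lower end), the fact that makes the transfer go through;
* 3BE specialisation (`ι = EmeryCoord`, `c = .nHoles`): `emeryLineCoords_update_nHoles` (the delivered six-vector does not read the filling),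
  `ignoresCoord_nHoles_of_emeryLineCoords` (hence EVERY S2 word of the seam shape `p ↦ W (emeryLineCoords εp p)` — energy floors, vertex words,
  Lipschitz transports — ignores `nHoles`), `flImage_update_nHoles` (reading fl commutes with re-pointing), `emeryCellFilling_update_nHoles` /
  `emeryCellFilling_mem_Icc_update_nHoles` (what DOES move: the cell filling handed to S2 is the re-pointed interval), and the packaged door
  **`holdsOn_update_nHoles_iff`**: a seam-shape word holds on the re-pointed box iff it holds on the original.

Everything here is PROVED (0 sorry); pure bookkeeping on `Function.update`; no physics beyond the definitions it quotes (`emeryLineCoords`,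
`flImage`, `emeryCellFilling`). WHAT THIS FILE IS NOT: a filling election (which `nHoles` row is of record stays the lead's ruling); a statement that
filling-DEPENDENT words (anything reading `ρ` through `emeryCellFilling`) transfer — they do not, and the file says where they move to.
-/

namespace Summit.Ventures.CertifiedManyBodySolver.Downfold

open NonemptyInterval

/-! ## §1 Generic: one coordinate re-pointed -/

section Generic

variable {ι : Type*} [DecidableEq ι]

/-- **Every entry is inhabited**: its lower end is a member. [folklore] -/
theorem Entry.fst_mem (e : Entry) : e.Mem ((e.encl.fst : ℚ) : ℝ) :=
  mem_ratCast_iff.2 ⟨le_rfl, by exact_mod_cast e.encl.fst_le_snd⟩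

/-! «`W` IGNORES COORDINATE `c`» is spelled out as the hypothesis `∀ p v, W p → W (Function.update p c v)` (changing the `c`-coordinate of a
parameter vector never falsifies `W`); no predicate is introduced for it. -/

/-- A word of the shape `p ↦ W' (F p)` ignores `c` as soon as the feature map `F` does. [folklore] -/
theorem Box.ignoresCoord_comp {α : Type*} {F : (ι → ℝ) → α} {c : ι} (hF : ∀ p v, F (Function.update p c v) = F p)
    (W' : α → Prop) : ∀ (p : ι → ℝ) (v : ℝ), W' (F p) → W' (F (Function.update p c v)) :=
  fun p v h => by simpa only [hF p v] using h

/-- A conjunction of `c`-blind words is `c`-blind. [folklore] -/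
theorem Box.ignoresCoord_and {W W' : (ι → ℝ) → Prop} {c : ι} (hW : ∀ (p : ι → ℝ) (v : ℝ), W p → W (Function.update p c v))
    (hW' : ∀ (p : ι → ℝ) (v : ℝ), W' p → W' (Function.update p c v)) :
    ∀ (p : ι → ℝ) (v : ℝ), (W p ∧ W' p) → (W (Function.update p c v) ∧ W' (Function.update p c v)) :=
  fun p v h => ⟨hW p v h.1, hW' p v h.2⟩

/-- **Pointwise re-pointing**: if `p ∈ B` and `v ∈ e` then `update p c v ∈ update B c (some e)`. [folklore] -/
theorem Box.mem_update_update {B : Box ι} {c : ι} {e : Entry} {p : ι → ℝ} (hp : B.Mem p) {v : ℝ} (hv : e.Mem v) :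
    Box.Mem (Function.update B c (some e)) (Function.update p c v) := by
  intro i f hi
  by_cases hic : i = c
  · subst hic
    rw [Function.update_self, Option.some.injEq] at hi
    subst hi
    rw [Function.update_self]
    exact hv
  · rw [Function.update_of_ne hic] at hi ⊢
    exact hp i f hi

/-- **Erasing an entry only enlarges the box**: a member of `B` with any `c`-coordinate is a member of `update B c none`. [folklore] -/
theorem Box.mem_update_none_update {B : Box ι} {c : ι} {p : ι → ℝ} (hp : B.Mem p) (v : ℝ) :
    Box.Mem (Function.update B c none) (Function.update p c v) := by
  intro i f hi
  by_cases hic : i = c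
  · subst hic; simp at hi
  · rw [Function.update_of_ne hic] at hi ⊢
    exact hp i f hi

/-- A member of the re-pointed box, moved back into the old `c` entry, is a member of the old box. [folklore] -/
theorem Box.mem_of_mem_update {B : Box ι} {c : ι} {x : Option Entry} {p : ι → ℝ} (hp : Box.Mem (Function.update B c x) p)
    {v : ℝ} (hv : ∀ f, B c = some f → f.Mem v) : B.Mem (Function.update p c v) := by
  intro i f hi
  by_cases hic : i = c
  · subst hic
    rw [Function.update_self]
    exact hv f hi
  · rw [Function.update_of_ne hic]
    exact hp i f (by rw [Function.update_of_ne hic]; exact hi)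

/-- **THE TRANSFER (old → re-pointed)**: a word that ignores `c` and holds on `B` holds on `B` with the `c` entry replaced by anything
(a new entry `some e`, or `none`). [folklore] -/
theorem HoldsOn.update_of_ignoresCoord {W : (ι → ℝ) → Prop} {c : ι} (hW : ∀ (p : ι → ℝ) (v : ℝ), W p → W (Function.update p c v))
    {B : Box ι} (h : HoldsOn W B)
    (x : Option Entry) : HoldsOn W (Function.update B c x) := by
  intro p hp
  -- move `p` back into the old `c` entry (its lower end if present), apply the word there, and re-point the coordinate
  have key : ∀ v : ℝ, (∀ f, B c = some f → f.Mem v) → W p := fun v hv => by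
    have hq : B.Mem (Function.update p c v) := Box.mem_of_mem_update hp hv
    have hWq := hW _ (p c) (h _ hq)
    simpa only [Function.update_idem, Function.update_eq_self] using hWq
  cases hB : B c with
  | none => exact key 0 (fun f hf => by rw [hB] at hf; cases hf)
  | some f₀ => exact key ((f₀.encl.fst : ℚ) : ℝ) (fun f hf => by rw [hB, Option.some.injEq] at hf; subst hf; exact Entry.fst_mem _)

/-- **THE TRANSFER BACK (re-pointed → old)**: `B` is the re-pointed box re-pointed to its own old entry. [folklore] -/
theorem HoldsOn.of_update_of_ignoresCoord {W : (ι → ℝ) → Prop} {c : ι} (hW : ∀ (p : ι → ℝ) (v : ℝ), W p → W (Function.update p c v))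
    {B : Box ι} {x : Option Entry}
    (h : HoldsOn W (Function.update B c x)) : HoldsOn W B := by
  have h' := HoldsOn.update_of_ignoresCoord hW h (B c)
  simpa only [Function.update_idem, Function.update_eq_self] using h'

/-- **A `c`-blind word holds on the re-pointed box iff it holds on the original.** [folklore] -/
theorem holdsOn_update_iff_of_ignoresCoord {W : (ι → ℝ) → Prop} {c : ι} (hW : ∀ (p : ι → ℝ) (v : ℝ), W p → W (Function.update p c v))
    (B : Box ι) (x : Option Entry) :
    HoldsOn W (Function.update B c x) ↔ HoldsOn W B :=
  ⟨HoldsOn.of_update_of_ignoresCoord hW, fun h => h.update_of_ignoresCoord hW x⟩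

/-- Re-pointings at two DIFFERENT coordinates commute. [folklore] -/
theorem Box.update_update_comm (B : Box ι) {c d : ι} (h : c ≠ d) (x y : Option Entry) :
    Function.update (Function.update B c x) d y = Function.update (Function.update B d y) c x :=
  Function.update_comm h _ _ _

end Generic

/-! ## §2 The 3BE seam: re-pointing the `nHoles` entry (a PER-PLANE FILLING variant) -/

/-- The delivered six-vector `(t_pd, t_pp, εp + Δ, εp, U_d, U_p)` does not read the filling coordinate. [folklore] -/
theorem emeryLineCoords_update_nHoles (εp : ℝ) (p : EmeryCoord → ℝ) (v : ℝ) :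
    emeryLineCoords εp (Function.update p .nHoles v) = emeryLineCoords εp p := by
  ext i; fin_cases i <;> simp [emeryLineCoords]

/-- **Every seam-shape word ignores `nHoles`**: `p ↦ W (emeryLineCoords εp p)` — the shape of ALL S2 statements transported by `S2SeamEmery`
(energy floors and two-sided words, vertex floors, Lipschitz transports) — is `nHoles`-blind. [folklore] -/
theorem ignoresCoord_nHoles_of_emeryLineCoords (εp : ℝ) (W : (Fin 6 → ℝ) → Prop) :
    ∀ (p : EmeryCoord → ℝ) (v : ℝ), W (emeryLineCoords εp p) → W (emeryLineCoords εp (Function.update p .nHoles v)) :=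
  Box.ignoresCoord_comp (fun p v => emeryLineCoords_update_nHoles εp p v) W

/-- Any word reading only coordinates other than `nHoles` through a feature map ignores `nHoles`; the instance every slice file uses:
`p ↦ W (p .tpd) (p .tpp) (p .DeltaPd) (p .Udd) (p .Upp) (p .tppP) (p .Vpd)`. [folklore] -/
theorem ignoresCoord_nHoles_of_coords (W : ℝ → ℝ → ℝ → ℝ → ℝ → ℝ → ℝ → Prop) :
    ∀ (p : EmeryCoord → ℝ) (v : ℝ), W (p .tpd) (p .tpp) (p .DeltaPd) (p .Udd) (p .Upp) (p .tppP) (p .Vpd) →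
      W (Function.update p .nHoles v .tpd) (Function.update p .nHoles v .tpp) (Function.update p .nHoles v .DeltaPd)
        (Function.update p .nHoles v .Udd) (Function.update p .nHoles v .Upp) (Function.update p .nHoles v .tppP) (Function.update p .nHoles v .Vpd) :=
  fun p v h => by simpa [Function.update_of_ne] using h

/-- **Reading fl commutes with re-pointing the filling**: the fl image of the re-pointed vector is the re-pointed fl image. [folklore] -/
theorem flImage_update_nHoles (nd np : ℝ) (p : EmeryCoord → ℝ) (v : ℝ) :
    flImage nd np (Function.update p .nHoles v) = Function.update (flImage nd np p) .nHoles v := by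
  ext c
  cases c <;> simp [flImage, Function.update, PictureMap.deltaE]

/-- **What DOES move**: the cell filling of the re-pointed vector is `(6 − v)/4`. [cite: ArakiMoriya2003, §4.1 Def. 4.5] -/
theorem emeryCellFilling_update_nHoles (p : EmeryCoord → ℝ) (v : ℝ) :
    emeryCellFilling (Function.update p .nHoles v) = (6 - v) / 4 := by
  simp [emeryCellFilling]

/-- **The filling enclosure of a re-pointed box** is the re-pointed one: `ρ ∈ [(6 − e.hi)/4, (6 − e.lo)/4]` on `update E .nHoles (some e)`.
[cite: ArakiMoriya2003, §4.1 Def. 4.5] -/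
theorem emeryCellFilling_mem_Icc_update_nHoles (E : EmeryBox) (e : Entry) {p : EmeryCoord → ℝ}
    (hp : Box.Mem (Function.update E .nHoles (some e)) p) :
    emeryCellFilling p ∈ Set.Icc ((((6 : ℚ) - e.encl.snd) / 4 : ℚ) : ℝ) ((((6 : ℚ) - e.encl.fst) / 4 : ℚ) : ℝ) :=
  emeryCellFilling_mem_Icc (E := Function.update E .nHoles (some e)) (eN := e) (Function.update_self _ _ _) hp

/-- The re-pointed box reads back the new `nHoles` entry and every other entry unchanged. [folklore] -/
theorem emeryBox_update_nHoles_apply (E : EmeryBox) (e : Entry) :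
    Function.update E .nHoles (some e) .nHoles = some e ∧
      ∀ c, c ≠ EmeryCoord.nHoles → Function.update E .nHoles (some e) c = E c :=
  ⟨Function.update_self _ _ _, fun _ hc => Function.update_of_ne hc _ _⟩

/-- **THE DOOR FOR PER-PLANE FILLING VARIANTS**: a seam-shape word `p ↦ W (emeryLineCoords εp p)` holds on the box with its `nHoles` entry re-pointed
(to any entry, or erased) iff it holds on the original box — energy floors, vertex-certified floors and Lipschitz-transported words typed on a plane's
site-mean companion hold verbatim on its per-plane-filling variant and conversely. [folklore] -/
theorem holdsOn_update_nHoles_iff (E : EmeryBox) (x : Option Entry) (εp : ℝ) (W : (Fin 6 → ℝ) → Prop) :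
    HoldsOn (fun p : EmeryCoord → ℝ => W (emeryLineCoords εp p)) (Function.update E .nHoles x) ↔
      HoldsOn (fun p : EmeryCoord → ℝ => W (emeryLineCoords εp p)) E :=
  holdsOn_update_iff_of_ignoresCoord (ignoresCoord_nHoles_of_emeryLineCoords εp W) E x

/-- **fl soundness transfers to the variant**: if reading fl maps the source box `S` into the slice `E` (at reference occupations `nd, np`), then it maps
the re-pointed source into the re-pointed slice (same entry `e` at `nHoles` on both sides). [folklore] -/
theorem flImage_mem_update_nHoles {S E : EmeryBox} {nd np : ℝ} (h : ∀ p, S.Mem p → E.Mem (flImage nd np p)) (e : Entry)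
    {p : EmeryCoord → ℝ} (hp : Box.Mem (Function.update S .nHoles (some e)) p) :
    Box.Mem (Function.update E .nHoles (some e)) (flImage nd np p) := by
  -- p with its filling moved back into S's old entry lies in S; its fl image lies in E; re-point the filling to p's own value
  have hpc : e.Mem (p .nHoles) := hp _ _ (Function.update_self _ _ _)
  have key : ∀ v : ℝ, (∀ f, S .nHoles = some f → f.Mem v) → Box.Mem (Function.update E .nHoles (some e)) (flImage nd np p) := by
    intro v hv
    have hq : S.Mem (Function.update p .nHoles v) := Box.mem_of_mem_update hp hv
    have hE := h _ hq
    rw [flImage_update_nHoles] at hE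
    have h2 := Box.mem_update_update hE (c := EmeryCoord.nHoles) (e := e) hpc
    rw [Function.update_idem] at h2
    have h3 : Function.update (flImage nd np p) EmeryCoord.nHoles (p .nHoles) = flImage nd np p := by
      ext c
      by_cases hc : c = EmeryCoord.nHoles
      · subst hc; rw [Function.update_self, flImage_of_ne (by decide)]
      · rw [Function.update_of_ne hc]
    rw [h3] at h2
    exact h2
  cases hS : S .nHoles with
  | none => exact key 0 (fun f hf => by rw [hS] at hf; cases hf)
  | some f₀ => exact key ((f₀.encl.fst : ℚ) : ℝ) (fun f hf => by rw [hS, Option.some.injEq] at hf; subst hf; exact Entry.fst_mem _)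

end Summit.Ventures.CertifiedManyBodySolver.Downfold
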